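import Summits.QuantumFields.QCD.Theses.PauliWegnerSea
import Literature.MathematicalPhysics.QuantumFieldTheory.QCDPhaseQuenchedReweighting

/-!
# Line `fibre-flatness-conditional-package` — shared CURRENCIES (definitions only, sorry-free)
for the skeleton `Lines/fibre-flatness-conditional-package.lean` of crux `PauliWegnerSea.GluonicCompletion`
(item stmt-QuantumFields-9152; routes route-QuantumFields-PauliWegnerSea [primary], route-QuantumFields-WilsonMobilityGap).

This module is importable (`import Summits.QuantumFields.QCD.Cruxes.GluonicCompletion.Lines.FibreFlatnessPackage`),
so that provers closing a registered stub of the line can state it BY THE SAME NAMES; the skeleton file itself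
(hyphenated, sorried) is not a module. Everything here is a transparent abbreviation over tree vocabulary
(`QCDOS`, `GrassmannIntegral`, `GaugeGroups`, `ConstructiveQFTWave0`, `LatticeModels`): no object is posited.
Namespace = the skeleton's (`…Cruxes.GluonicCompletion.FibreFlatnessConditionalPackage`).

* `ClauseI … ClauseIV reg m` — the four per-mass clauses of the crux's hypothesis `H`, VERBATIM (the composition
  destructures `H` into them definitionally).
* `LocalFibreDomination` (K1_loc), `BandLimitedFlatness` (K3_gen) — the fibre lemmas of route PauliWegnerSea in the
  local / twisted / general band-limited form the line needs (statements of stubs 1, 2).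
* `CondDecay`, `GlueCore`, `LatticeGapUniform` — the three currencies exchanged between stubs 3–6.
* `subseq reg φ hφ` — the regularisation along a subsequence (`QCDOf`'s own `reg'`), `hasMassScaling_subseq`.
See the skeleton's module docstring for the architecture, where `H` enters, and the Disproof/Negative checks.
-/

noncomputable section

open MeasureTheory Filter
open Literature.MathematicalPhysics.QuantumFieldTheory Literature.MathematicalPhysics.QuantumLattice
  Literature.Probability.LatticeModels
open scoped BigOperators Classical

namespace Summit.QuantumFields.QCD.Cruxes.GluonicCompletion.FibreFlatnessConditionalPackage

variable {Nf : ℕ}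

/-- Clause (i) of the per-mass package of `H` for `(reg, m)` — verbatim: bare masses on the physical branch. -/
def ClauseI (reg : QCDRegularisation Nf) (m : Fin Nf → ℝ) : Prop :=
  ∀ f : Fin Nf, ∀ᶠ k in atTop, -1 < reg.mcrit k + reg.a k * m f / reg.Zm k

/-- Clause (ii) of `H` for `(reg, m)` — verbatim: phase-quenched fractional-moment decay of the quark propagator,
global (full torus), untwisted, with `m`-pointwise constants. Consumed by stubs 3 and 4 only as a SEED. -/
def ClauseII (reg : QCDRegularisation Nf) (m : Fin Nf → ℝ) : Prop :=
  ∃ s δ C : ℝ, 0 < s ∧ s < 1 ∧ 0 < δ ∧ ∀ᶠ k in atTop, ∀ S : ℕ, reg.L k ≤ S → ∀ (f : Fin Nf) (v : Literature.Probability.LatticeModels.Site 4), v ∈ box 4 S → (∫ U : GaugeConfig 4 (2 * S + 1) (Matrix.specialUnitaryGroup (Fin 3) ℂ), ‖(diracMatrix U fun fl => reg.mcrit k + reg.a k * m fl / reg.Zm k).det‖ * (∑ a : Fin 3, ∑ i : Fin 4, ∑ b : Fin 3, ∑ j : Fin 4, ‖(diracMatrix U fun fl => reg.mcrit k + reg.a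 k * m fl / reg.Zm k)⁻¹ (quarkEquiv (f, (Torus.proj (2 * S + 1) 0, a, i))) (quarkEquiv (f, (Torus.proj (2 * S + 1) (v), b, j)))‖) ^ s ∂(wilsonMeasure (fundamentalRep (Fin 3)) (reg.β k))) / (∫ U : GaugeConfig 4 (2 * S + 1) (Matrix.specialUnitaryGroup (Fin 3) ℂ), ‖(diracMatrix U fun fl => reg.mcrit k + reg.a k * m fl / reg.Zm k).det‖ ∂(wilsonMeasure (fundamentalRep (Fin 3)) (reg.β k))) ≤ C * Real.exp (-(δ * (reg.a k * ‖v‖)))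

/-- Clause (iii) of `H` for `(reg, m)` — verbatim: quarks are not lattice-heavy (lower bound). Consumed by stub 6
(non-decoupling of the flavour-changing pseudoscalars). -/
def ClauseIII (reg : QCDRegularisation Nf) (m : Fin Nf → ℝ) : Prop :=
  ∃ s c₀ C₁ p : ℝ, 0 < s ∧ s < 1 ∧ 0 < c₀ ∧ ∀ᶠ k in atTop, ∀ S : ℕ, reg.L k ≤ S → ∀ (f : Fin Nf) (n : ℕ), n ≤ S → c₀ * Real.exp (-(C₁ * (reg.a k * n) + p * Real.log (n + 1))) ≤ (∫ U : GaugeConfig 4 (2 * S + 1) (Matrix.specialUnitaryGroup (Fin 3) ℂ), ‖(diracMatrix U fun fl => reg.mcrit k + reg.a k * m fl / reg.Zm k).det‖ * (∑ a : Fin 3, ∑ i : Fin 4, ∑ b : Fin 3, ∑ j : Fin 4, ‖(diracMatrix U fun fl => reg.mcrit k + reg.a k * m fl / reg.Zm k)⁻¹ (quarkEquiv (f, (Torus.proj (2 * S + 1) 0, a, i))) (quarkEquiv (f, (Torus.proj (2 * S + 1) (Pi.single 0 (n : ℤ)), b, j)))‖) ^ s ∂(wilsonMeasure (fundamentalRep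 (Fin 3)) (reg.β k))) / (∫ U : GaugeConfig 4 (2 * S + 1) (Matrix.specialUnitaryGroup (Fin 3) ℂ), ‖(diracMatrix U fun fl => reg.mcrit k + reg.a k * m fl / reg.Zm k).det‖ ∂(wilsonMeasure (fundamentalRep (Fin 3)) (reg.β k)))

/-- Clause (iv) of `H` for `(reg, m)` — verbatim: sign coherence `≥ ½` at the scheme's OWN side `2L_k+1` only.
Consumed by stub 5 (defect rarity by extensivity) and stub 6 (factor-2 budget at the scheme volume). -/
def ClauseIV (reg : QCDRegularisation Nf) (m : Fin Nf → ℝ) : Prop :=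
  ∀ᶠ k in atTop, (1 / 2 : ℝ) ≤ ‖∫ U : GaugeConfig 4 (2 * reg.L k + 1) (Matrix.specialUnitaryGroup (Fin 3) ℂ), (diracMatrix U fun fl => reg.mcrit k + reg.a k * m fl / reg.Zm k).det ∂(wilsonMeasure (fundamentalRep (Fin 3)) (reg.β k))‖ / (∫ U : GaugeConfig 4 (2 * reg.L k + 1) (Matrix.specialUnitaryGroup (Fin 3) ℂ), ‖(diracMatrix U fun fl => reg.mcrit k + reg.a k * m fl / reg.Zm k).det‖ ∂(wilsonMeasure (fundamentalRep (Fin 3)) (reg.β k)))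

/-- **K1_loc — local two-star fibre cofactor domination** (the deterministic fibre lemma, Dirichlet-cut and
twisted). There are `C₀ > 0`, `p₀` such that for every bare mass `m₀ ∈ [−2,2]`, twist `|η| ≤ 1`, torus of side
`L ≥ 4`, box `Λ_r = proj(box 4 r)`, background `U` and sites `x ≠ y ∈ Λ_r`: with `refit W` = `U` with the links of
`star(x) ∪ star(y)` replaced by those of `W`, and `D(V)` = the Wilson–Dirac matrix of `V` at mass `m₀`, `r = 1`,
twisted by `−iη Γ₅`, CUT to `Λ_r` (entries with both sites in `Λ_r` kept, identity on the complement, no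
coupling across — so `det D = det D_Λ`, `adj D|_Λ = adj D_Λ`),
`∀ W ∃ W', Σ_{a,i,b,j} ‖adj D(refit W)_{(x,a,i),(y,b,j)}‖ ≤ C₀ (1+r)^{p₀} ‖det D(refit W')‖`.
For `2r+1 ≥ L` the cut is the full periodic operator and this is K1 (11510) with `1 + n_w ≤ 13 L⁴` absorbed in
`(1+r)^{p₀}`; for genuine boxes it is K1 for the Dirichlet operator, whose in-window count is at most its dimension.
Mechanism as K1 (`γ₅`-hermiticity: every pole of `adj/det` carries the same `H_W`-eigenvector at both ends; a
simple zero mode supported off `{x,y}` kills `adj_xy` too); at `η ≠ 0` it holds trivially with `C = 1/|η|`, the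
content is uniformity as `η → 0`. -/
def LocalFibreDomination : Prop :=
  ∃ (C₀ : ℝ) (p₀ : ℕ), 0 < C₀ ∧ ∀ (m₀ η : ℝ), -2 ≤ m₀ → m₀ ≤ 2 → |η| ≤ 1 →
    ∀ (L : ℕ) [NeZero L], 4 ≤ L → ∀ (r : ℕ) (U : GaugeConfig 4 L SU3) (x y : TorusSite 4 L), x ≠ y →
      (∃ u ∈ box 4 r, Torus.proj L u = x) → (∃ v ∈ box 4 r, Torus.proj L v = y) →
      let Λ : TorusSite 4 L → Prop := fun z => ∃ w ∈ box 4 r, Torus.proj L w = z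
      let star : Edge 4 L → Prop := fun e =>
        e.1 = x ∨ Site.shift e.1 e.2 = x ∨ e.1 = y ∨ Site.shift e.1 e.2 = y
      let refit : GaugeConfig 4 L SU3 → GaugeConfig 4 L SU3 := fun W e => if star e then W e else U e
      let D : GaugeConfig 4 L SU3 →
          Matrix (TorusSite 4 L × Fin 3 × Fin 4) (TorusSite 4 L × Fin 3 × Fin 4) ℂ := fun V =>
        let Dfull : Matrix (TorusSite 4 L × Fin 3 × Fin 4) (TorusSite 4 L × Fin 3 × Fin 4) ℂ :=
          wilsonDirac (fundamentalRep (Fin 3)) V m₀ 1 -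
            ((η : ℂ) * Complex.I) • spinorLift (L := L) (N := 3) gammaFive
        Matrix.of fun p q => if Λ p.1 ∧ Λ q.1 then Dfull p q else if p = q then 1 else 0
      ∀ W : GaugeConfig 4 L SU3, ∃ W' : GaugeConfig 4 L SU3,
        (∑ a : Fin 3, ∑ i : Fin 4, ∑ b : Fin 3, ∑ j : Fin 4, ‖(D (refit W)).adjugate (x, a, i) (y, b, j)‖) ≤
          C₀ * (1 + (r : ℝ)) ^ p₀ * ‖(D (refit W')).det‖

/-- **K3_gen — tilted flatness for every band-limited weight the line meets** (`TiltedFlatness` 11511 is the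
case: full torus, `η = 0`, `n = N_f`, via `det_diracMatrix`). For every `N` there are `C, p, c > 0` such that for
every `β ≥ 0`, `n ≤ N`, masses `mq ∈ [−2,2]^n`, twists `|η_f| ≤ 1`, torus `L ≥ 4`, box radius `r`, background `U`
and sites `x, y`: with `F(W) = ∏_{f<n} |det D_f(refit W)|` (`D_f` = Wilson–Dirac at `mq f`, twisted by
`−iη_f Γ₅`, cut to `Λ_r`; band-limited of bidegree `≤ (6n, 6n)` in each of the `≤ 16` star links — Pauli, and
`TwistedPauliBandLimit`: the twist is link-independent), `wt(W) = exp(−β S_W(refit W))`, `Z = ∫ wt dHaar`,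
`M = ∫ F wt dHaar / Z`: (a) `F(W₀) ≤ C (1+β)^p M` for all `W₀`; (b) if `M > 0`, `∫ 1{F ≤ εM} wt / Z ≤ C ε^c`.
Constants depend on the DEGREE (`N`) only — uniformly in `β`, masses, twists, the box, the volume and the OUTSIDE
configuration. Inherits 11511's recorded risk ((b) uniformly in `β`: two minimising branches of the tilted
action ⇒ an atom of `F/M` at `0`). -/
def BandLimitedFlatness : Prop :=
  ∀ N : ℕ, ∃ C p c : ℝ, 0 < C ∧ 0 < c ∧ ∀ β : ℝ, 0 ≤ β → ∀ n : ℕ, n ≤ N →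
    ∀ (mq η : Fin n → ℝ), (∀ f, -2 ≤ mq f ∧ mq f ≤ 2) → (∀ f, |η f| ≤ 1) →
    ∀ (L : ℕ) [NeZero L], 4 ≤ L → ∀ (r : ℕ) (U : GaugeConfig 4 L SU3) (x y : TorusSite 4 L),
      let Λ : TorusSite 4 L → Prop := fun z => ∃ w ∈ box 4 r, Torus.proj L w = z
      let star : Edge 4 L → Prop := fun e =>
        e.1 = x ∨ Site.shift e.1 e.2 = x ∨ e.1 = y ∨ Site.shift e.1 e.2 = y
      let refit : GaugeConfig 4 L SU3 → GaugeConfig 4 L SU3 := fun W e => if star e then W e else U e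
      let D : Fin n → GaugeConfig 4 L SU3 →
          Matrix (TorusSite 4 L × Fin 3 × Fin 4) (TorusSite 4 L × Fin 3 × Fin 4) ℂ := fun f V =>
        let Dfull : Matrix (TorusSite 4 L × Fin 3 × Fin 4) (TorusSite 4 L × Fin 3 × Fin 4) ℂ :=
          wilsonDirac (fundamentalRep (Fin 3)) V (mq f) 1 -
            ((η f : ℂ) * Complex.I) • spinorLift (L := L) (N := 3) gammaFive
        Matrix.of fun p q => if Λ p.1 ∧ Λ q.1 then Dfull p q else if p = q then 1 else 0
      let F : GaugeConfig 4 L SU3 → ℝ := fun W => ∏ f : Fin n, ‖(D f (refit W)).det‖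
      let wt : GaugeConfig 4 L SU3 → ℝ := fun W =>
        Real.exp (-(β * wilsonAction (fundamentalRep (Fin 3)) (refit W)))
      let haar : Measure (GaugeConfig 4 L SU3) := Measure.pi fun _ => haarProbability SU3
      let Z : ℝ := ∫ W, wt W ∂haar
      let M : ℝ := (∫ W, F W * wt W ∂haar) / Z
      (∀ W₀ : GaugeConfig 4 L SU3, F W₀ ≤ C * (1 + β) ^ p * M) ∧
        (0 < M → ∀ ε : ℝ, 0 < ε → (∫ W, (if F W ≤ ε * M then (1 : ℝ) else 0) * wt W ∂haar) / Z ≤ C * ε ^ c)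

/-- **CondDecay — conditional, twisted, mass-locally-uniform fractional-moment decay, for all but rare
environments** (the currency the completion engine consumes; the conclusion of stub 3). For every compact mass
window `[mlo, mhi]`, `0 < mlo`, and every power `q` there are `s ∈ (0,1)`, `δ, C, η₀ > 0` such that for all large
`k`, every torus `S ≥ L_k`, every mass tuple in the window, every twist `|η_f| ≤ η₀` and every GENUINE box
`Λ_r = proj(box 4 r)`, `r < S` (Dirichlet cut, no wrap-around), there is a measurable set `Bad` of configurations of
phase-quenched probability `⟨1_Bad⟩₊ ≤ C a_k^q` such that for every environment `U ∉ Bad`, every flavour `f` and all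
sites `u, v` of the INNER half-box `box 4 (r/2)`:
`E[ (Σ_{a,i,b,j} |(D_cut,η)⁻¹_{(f,u,a,i),(f,v,b,j)}|)^s | links outside Λ_r = U ] ≤ C exp(−δ a_k ‖u − v‖_∞)`,
the conditional law of the inside links (both endpoints in `Λ_r`) being the phase-quenched one: density
`∝ |det diracMatrix(refit W; m(k))| · exp(−β_k S_W(refit W))` w.r.t. product Haar (FULL-torus, UNtwisted determinant
weight; only the observable is cut and twisted). Rate `δ` physical; `C` uniform in `k`, `S`, the good environments,
the box and `m ∈ K`. Why "all but rare environments" and "inner half-box": a uniform bound over ALL environments up to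
the box boundary would have to survive environment-induced rough boundary layers (in-gap modes of `H_W` along `∂Λ_r`);
deep inside, reaching such a layer already costs the claimed rate, and atypical coherent environments are excised by
`Bad` (their rarity is what (ii) + the fibre lemmas give by Markov — stub 3). Junk-safe: a vanishing or non-integrable
fibre integral reads `0 ≤ …`. -/
def CondDecay (Nf : ℕ) (reg : QCDRegularisation Nf) : Prop :=
  ∀ mlo mhi : ℝ, 0 < mlo → mlo ≤ mhi → ∀ q : ℕ,
    ∃ s δ C η₀ : ℝ, 0 < s ∧ s < 1 ∧ 0 < δ ∧ 0 < η₀ ∧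
      ∀ᶠ k in atTop, ∀ S : ℕ, reg.L k ≤ S →
        ∀ m : Fin Nf → ℝ, (∀ f, mlo ≤ m f ∧ m f ≤ mhi) →
        ∀ η : Fin Nf → ℝ, (∀ f, |η f| ≤ η₀) →
        ∀ r : ℕ, r < S →
          let mb : Fin Nf → ℝ := fun fl => reg.mcrit k + reg.a k * m fl / reg.Zm k
          ∃ Bad : Set (GaugeConfig 4 (2 * S + 1) SU3), MeasurableSet Bad ∧
            qcdPhaseQuenchedExpect (reg.β k) (2 * S + 1) mb (Bad.indicator fun _ => (1 : ℝ)) ≤ C * reg.a k ^ q ∧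
            ∀ (U : GaugeConfig 4 (2 * S + 1) SU3), U ∉ Bad →
            ∀ (f : Fin Nf) (u v : Literature.Probability.LatticeModels.Site 4),
              u ∈ box 4 (r / 2) → v ∈ box 4 (r / 2) →
              let Λ : TorusSite 4 (2 * S + 1) → Prop := fun z => ∃ w ∈ box 4 r, Torus.proj (2 * S + 1) w = z
              let inside : Edge 4 (2 * S + 1) → Prop := fun e => Λ e.1 ∧ Λ (Site.shift e.1 e.2)
              let refit : GaugeConfig 4 (2 * S + 1) SU3 → GaugeConfig 4 (2 * S + 1) SU3 :=
                fun W e => if inside e then W e else U e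
              let F : GaugeConfig 4 (2 * S + 1) SU3 → ℝ := fun W => ‖(diracMatrix (refit W) mb).det‖
              let wt : GaugeConfig 4 (2 * S + 1) SU3 → ℝ := fun W =>
                Real.exp (-(reg.β k * wilsonAction (fundamentalRep (Fin 3)) (refit W)))
              let haar : Measure (GaugeConfig 4 (2 * S + 1) SU3) := Measure.pi fun _ => haarProbability SU3
              let Dcut : GaugeConfig 4 (2 * S + 1) SU3 →
                  Matrix (FermiIdx Nf (2 * S + 1)) (FermiIdx Nf (2 * S + 1)) ℂ := fun W =>
                let Dη : Matrix (FermiIdx Nf (2 * S + 1)) (FermiIdx Nf (2 * S + 1)) ℂ :=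
                  Matrix.reindex quarkEquiv quarkEquiv (Matrix.of fun p q : QuarkVar Nf (2 * S + 1) =>
                    if p.1 = q.1 then
                      (wilsonDirac (fundamentalRep (Fin 3)) (refit W) (mb p.1) 1 -
                        ((η p.1 : ℂ) * Complex.I) • spinorLift (L := 2 * S + 1) (N := 3) gammaFive) p.2 q.2
                    else 0)
                Matrix.of fun i j =>
                  if Λ (quarkEquiv.symm i).2.1 ∧ Λ (quarkEquiv.symm j).2.1 then Dη i j
                  else if i = j then 1 else 0
              let G : GaugeConfig 4 (2 * S + 1) SU3 → ℝ := fun W =>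
                ∑ a : Fin 3, ∑ i : Fin 4, ∑ b : Fin 3, ∑ j : Fin 4,
                  ‖(Dcut W)⁻¹ (quarkEquiv (f, (Torus.proj (2 * S + 1) u, a, i)))
                    (quarkEquiv (f, (Torus.proj (2 * S + 1) v, b, j)))‖
              (∫ W, G W ^ s * (F W * wt W) ∂haar) / (∫ W, F W * wt W ∂haar) ≤
                C * Real.exp (-(δ * (reg.a k * ‖u - v‖)))

/-- **GlueCore — strong mixing of the phase-quenched conditional law at a physical rate, for all but rare
environments** (the Yang–Mills-hard core of the line, conclusion of stub 4, input of stubs 3, 5, 6). For every mass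
window and power `q` there are `γ > 0`, `C` such that for all large `k`, all `S ≥ L_k`, masses in the window and radii
`r' ≤ r < S` there is a measurable `Bad` with `⟨1_Bad⟩₊ ≤ C a_k^q` such that for any two environments `U, U' ∉ Bad`
and any measurable `g : configurations → [0,1]` depending only on the links inside `Λ_{r'}`: the conditional
phase-quenched expectations of `g` on the box `Λ_r` given the outside `U`, resp. `U'` (density
`∝ |det diracMatrix(refit W)| exp(−β_k S_W(refit W))`, FULL-torus determinant — the coupled, non-local weight is kept,
nothing finite-range is pretended), differ by at most `C (1 + a_k r')⁴ exp(−γ a_k (r − r'))` — prefactor in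
PHYSICAL units of the inner box, so the statement is uniform at fixed physical geometry as `a_k → 0`. Why "all but
rare environments": uniformly over ALL lattice-rough environments such total-variation closeness fails already for a
massive free field near its continuum limit (coherent rough boundary data carry unbounded physical energy); typical
environments average out (harmonic extension of lattice noise is `O(a_k)` at physical distance), and the atypical
ones are what `Bad` excises. -/
def GlueCore (Nf : ℕ) (reg : QCDRegularisation Nf) : Prop :=
  ∀ mlo mhi : ℝ, 0 < mlo → mlo ≤ mhi → ∀ q : ℕ,
    ∃ γ C : ℝ, 0 < γ ∧
      ∀ᶠ k in atTop, ∀ S : ℕ, reg.L k ≤ S →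
        ∀ m : Fin Nf → ℝ, (∀ f, mlo ≤ m f ∧ m f ≤ mhi) →
        ∀ r r' : ℕ, r' ≤ r → r < S →
          let mb : Fin Nf → ℝ := fun fl => reg.mcrit k + reg.a k * m fl / reg.Zm k
          let Λ : ℕ → TorusSite 4 (2 * S + 1) → Prop := fun ρ z => ∃ w ∈ box 4 ρ, Torus.proj (2 * S + 1) w = z
          let inside : ℕ → Edge 4 (2 * S + 1) → Prop := fun ρ e => Λ ρ e.1 ∧ Λ ρ (Site.shift e.1 e.2)
          let haar : Measure (GaugeConfig 4 (2 * S + 1) SU3) := Measure.pi fun _ => haarProbability SU3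
          let condExp : GaugeConfig 4 (2 * S + 1) SU3 → (GaugeConfig 4 (2 * S + 1) SU3 → ℝ) → ℝ := fun V g =>
            let refit : GaugeConfig 4 (2 * S + 1) SU3 → GaugeConfig 4 (2 * S + 1) SU3 :=
              fun W e => if inside r e then W e else V e
            let F : GaugeConfig 4 (2 * S + 1) SU3 → ℝ := fun W => ‖(diracMatrix (refit W) mb).det‖
            let wt : GaugeConfig 4 (2 * S + 1) SU3 → ℝ := fun W =>
              Real.exp (-(reg.β k * wilsonAction (fundamentalRep (Fin 3)) (refit W)))
            (∫ W, g (refit W) * (F W * wt W) ∂haar) / (∫ W, F W * wt W ∂haar)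
          ∃ Bad : Set (GaugeConfig 4 (2 * S + 1) SU3), MeasurableSet Bad ∧
            qcdPhaseQuenchedExpect (reg.β k) (2 * S + 1) mb (Bad.indicator fun _ => (1 : ℝ)) ≤ C * reg.a k ^ q ∧
            ∀ (U U' : GaugeConfig 4 (2 * S + 1) SU3), U ∉ Bad → U' ∉ Bad →
            ∀ (g : GaugeConfig 4 (2 * S + 1) SU3 → ℝ), Measurable g → (∀ W, 0 ≤ g W ∧ g W ≤ 1) →
              (∀ W W' : GaugeConfig 4 (2 * S + 1) SU3, (∀ e, inside r' e → W e = W' e) → g W = g W') →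
              |condExp U g - condExp U' g| ≤
                C * (1 + reg.a k * r') ^ 4 * Real.exp (-(γ * (reg.a k * ((r : ℝ) - r'))))

/-- **LatticeGapUniform — the all-volume, all-observable, SIGNED lattice gap with `m`-locally-uniform constants**
(conclusion of stub 5): for every mass window there is `Δ > 0` such that for every pair of gauge-invariant local
lattice QCD observables there is `C` with, for all large `k`, all masses in the window, all tori `S ≥ L_k` and
`n ≤ S`, `‖⟨A · τ_{ne₀}B⟩_{k,S} − ⟨A⟩⟨B⟩‖ ≤ C e^{−Δ a_k n}` (honest signed functional `qcdLatticeConnectedCorr`).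
Specialises to `(reg.scheme m z shift).HasLatticeMassGap Δ` for each `m`, and passes to subsequences. -/
def LatticeGapUniform (Nf : ℕ) (reg : QCDRegularisation Nf) : Prop :=
  ∀ mlo mhi : ℝ, 0 < mlo → mlo ≤ mhi → ∃ Δ : ℝ, 0 < Δ ∧
    ∀ (R R' : ℕ) (A : QCDLatticeObservable Nf R) (B : QCDLatticeObservable Nf R'), ∃ C : ℝ,
      ∀ᶠ k in atTop, ∀ m : Fin Nf → ℝ, (∀ f, mlo ≤ m f ∧ m f ≤ mhi) → ∀ S : ℕ, reg.L k ≤ S → ∀ n : ℕ, n ≤ S →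
        ‖qcdLatticeConnectedCorr (reg.β k) (2 * S + 1) (fun fl => reg.mcrit k + reg.a k * m fl / reg.Zm k) A B n‖ ≤
          C * Real.exp (-(Δ * (reg.a k * n)))

/-- The regularisation read along the subsequence `φ` (`a, β, L, m_crit, Z_m` precomposed; the `Tendsto` fields
pass by `StrictMono.tendsto_atTop`). `QCDOf`'s own `reg'` in the composition. -/
def subseq (reg : QCDRegularisation Nf) (φ : ℕ → ℕ) (hφ : StrictMono φ) : QCDRegularisation Nf where
  a := reg.a ∘ φ
  a_pos k := reg.a_pos (φ k)
  tendsto_a := reg.tendsto_a.comp hφ.tendsto_atTop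
  β := reg.β ∘ φ
  L := reg.L ∘ φ
  tendsto_L := reg.tendsto_L.comp hφ.tendsto_atTop
  mcrit := reg.mcrit ∘ φ
  Zm := reg.Zm ∘ φ
  Zm_pos k := reg.Zm_pos (φ k)

/-- `HasMassScaling` passes to subsequences. -/
theorem hasMassScaling_subseq {reg : QCDRegularisation Nf} (h : reg.HasMassScaling) (φ : ℕ → ℕ)
    (hφ : StrictMono φ) : (subseq reg φ hφ).HasMassScaling := by
  obtain ⟨c, hc, ht⟩ := h
  exact ⟨c, hc, ht.comp hφ.tendsto_atTop⟩

/-- Unfolding the subsequence scheme: torus half-sides. -/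
@[simp] theorem subseq_scheme_L (reg : QCDRegularisation Nf) (φ : ℕ → ℕ) (hφ : StrictMono φ)
    (m : Fin Nf → ℝ) (z shift : QCDField Nf → ℕ → ℝ) (k : ℕ) :
    ((subseq reg φ hφ).scheme m z shift).L k = reg.L (φ k) := rfl

/-- Unfolding the subsequence scheme: bare masses. -/
@[simp] theorem subseq_scheme_mq (reg : QCDRegularisation Nf) (φ : ℕ → ℕ) (hφ : StrictMono φ)
    (m : Fin Nf → ℝ) (z shift : QCDField Nf → ℕ → ℝ) (fl : Fin Nf) (k : ℕ) :
    ((subseq reg φ hφ).scheme m z shift).mq fl k = reg.mcrit (φ k) + reg.a (φ k) * m fl / reg.Zm (φ k) := rfl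

end Summit.QuantumFields.QCD.Cruxes.GluonicCompletion.FibreFlatnessConditionalPackage

end
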